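import Summits.QuantumFields.YangMills.Theorems.LangevinControlUVFemtoCurvatureTwoPointCDoublingSublevel
import Summits.QuantumFields.YangMills.Theorems.LangevinControlUVFemtoCurvatureTwoPointCStubExpCommutatorBracket
import Summits.QuantumFields.YangMills.Theorems.LangevinControlUVFemtoCurvatureTwoPointCStubKoszulH1
import Summits.QuantumFields.YangMills.Theorems.LangevinControlUVFemtoCurvatureTwoPointCStubHaarCoLipschitz
import HarnessLib

/-!
# Route `LangevinControlUV`, crux `FemtoCurvatureTwoPointC` (stmt-QuantumFields-16204), line
# `conditional-covariance-floor` — V-corner, input (i): sublevel doubling of the COMMUTATOR COST on `G⁴`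

The open lemma behind the V-corner stub is the uniform corner doubling UDC
(`Z_L(β/2) ≤ e^{A L⁴} Z_L(β)` for `L⁴ < log β`; bridge `varianceCeilingCorner_of_uniformDoublingCorner`,
`…CCornerBridge`). Conditioning the comb-gauge torus integral on its four critical wrap links
`w = (w_μ) ∈ G⁴` (the based axis holonomies; `…CTorusCombGauge`, `…CTorusTopLinkSharp`) squeezes the
`w`-marginal of `Z_L` between ONE-SITE Boltzmann weights `e^{−c β f(w)}` of the commutator cost

  `f(g₁, …, g₄) = Σ_{μ<ν} (N − Re tr ρ(g_μ g_ν g_μ⁻¹ g_ν⁻¹))`,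

which is EXACTLY Wilson's action on the one-site torus `(ℤ/1)⁴` (four links `g_μ = U(0, μ)`, six
plaquettes `U_{0;μν} = [g_μ, g_ν]` since `0 + e_μ = 0`). This file records that identification and the
resulting input (i) of the corner analysis, with NO new mathematics:

* `OneSite.plaquetteHolonomy_eq_commutator`, `OneSite.wilsonAction_eq_commutatorCost` — on `(ℤ/1)⁴`
  every plaquette holonomy is a group commutator of two links at `0` and `S = f`;
* `commutatorCost_sublevelDoubling` (registered sub-goal, `--supports stmt-QuantumFields-16204`) —
  for every compact `G` with a lattice representation `r`: `K, t₀ > 0` with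
  `Haar^{⊗4}{f ≤ t} ≤ K · Haar^{⊗4}{f ≤ t/4}` for `0 < t ≤ t₀` (product Haar on the four links of
  `(ℤ/1)⁴`), the `L = 1` instance of the landed conical sublevel doubling `stub_sublevelDoubling`
  (p-landed with its three inputs `stub_expCommutatorBracket`, `stub_koszulH1`, `stub_haarCoLipschitz`):
  the commuting variety `Hom(ℤ⁴, G) ⊂ G⁴` is conical in exponential slices at EVERY commuting
  quadruple, regular or not — no resolution of singularities, no log-canonical threshold.

Deliberately NOT here: the one-site PARTITION-FUNCTION doubling `Z₁(b/2) ≤ K' Z₁(b)` (all `b > 0`;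
Laplace bookkeeping as in `…CStubSecondMomentOfDoubling`) and the holonomy-conditioned torus sandwich
— see the line's notes `Vc-notes.md`.
-/

set_option autoImplicit false

noncomputable section

open MeasureTheory
open scoped ENNReal NNReal BigOperators
open Literature.MathematicalPhysics.QuantumFieldTheory

namespace Summit.QuantumFields.YangMills.Theorems.FemtoCurvatureTwoPointC

namespace OneSite

variable {G : Type*} [Group G]

/-- On the one-site torus `(ℤ/1)⁴` every site is `0`. -/
theorem site_eq_zero (x : Site 4 1) : x = 0 := Subsingleton.elim x 0

/-- **On `(ℤ/1)⁴` every plaquette holonomy is a group commutator**: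
`U_{x;ij} = U(0,i) U(0,j) U(0,i)⁻¹ U(0,j)⁻¹` (all sites coincide, `x + e_i = x = 0`). -/
theorem plaquetteHolonomy_eq_commutator (U : GaugeConfig 4 1 G) (x : Site 4 1) (i j : Fin 4) :
    plaquetteHolonomy U x i j = U (0, i) * U (0, j) * (U (0, i))⁻¹ * (U (0, j))⁻¹ := by
  rw [plaquetteHolonomy, site_eq_zero (x.shift i), site_eq_zero (x.shift j), site_eq_zero x]

/-- **Wilson's action on `(ℤ/1)⁴` is the commutator cost** of the four links at `0`:
`S(U) = Σ_{μ<ν} (N − Re tr ρ(U(0,μ) U(0,ν) U(0,μ)⁻¹ U(0,ν)⁻¹))` (six unordered direction pairs). -/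
theorem wilsonAction_eq_commutatorCost {N : ℕ} (ρ : G →* Matrix (Fin N) (Fin N) ℂ)
    (U : GaugeConfig 4 1 G) :
    wilsonAction ρ U = ∑ q : {q : Fin 4 × Fin 4 // q.1 < q.2},
      ((N : ℝ) - (ρ (U (0, q.1.1) * U (0, q.1.2) * (U (0, q.1.1))⁻¹ * (U (0, q.1.2))⁻¹)).trace.re) := by
  unfold wilsonAction
  rw [Fintype.sum_prod_type, Fintype.sum_unique]
  simp only [plaquetteHolonomy_eq_commutator]

end OneSite

/-- **Registered sub-goal `commutatorCost_sublevelDoubling` — input (i) of the V-corner analysis of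
line `conditional-covariance-floor`: sublevel-volume doubling of the commutator cost on `G⁴`.** For
every compact group `G` (any Borel structure) with a lattice representation `r` there are `K` and
`t₀ > 0` such that for `0 < t ≤ t₀`

  `Haar^{⊗4}{g | f(g) ≤ t} ≤ K · Haar^{⊗4}{g | f(g) ≤ t/4}`,
  `f(g) = Σ_{μ<ν} (N − Re tr r.ρ(g_μ g_ν g_μ⁻¹ g_ν⁻¹))`,

the four group elements being indexed by the links `(0, μ)` of the one-site torus `(ℤ/1)⁴` and
`Haar^{⊗4}` the product of the Haar probability measures. This is the `L = 1` instance of the landed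
conical sublevel doubling of Wilson's action on a fixed torus (`stub_sublevelDoubling` with its landed
inputs `stub_expCommutatorBracket`, `stub_koszulH1`, `stub_haarCoLipschitz`), read through
`OneSite.wilsonAction_eq_commutatorCost`. -/
theorem commutatorCost_sublevelDoubling :
    ∀ (G : Type) [Group G] [TopologicalSpace G] [IsTopologicalGroup G] [CompactSpace G]
      [MeasurableSpace G] [BorelSpace G] (r : LatticeRep G),
      ∃ (K : NNReal) (t₀ : ℝ), 0 < t₀ ∧ ∀ t : ℝ, 0 < t → t ≤ t₀ →
        MeasureTheory.Measure.pi (fun _ : Edge 4 1 => haarProbability G)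
            {U : GaugeConfig 4 1 G | ∑ q : {q : Fin 4 × Fin 4 // q.1 < q.2},
              ((r.N : ℝ) - (r.ρ (U (0, q.1.1) * U (0, q.1.2) * (U (0, q.1.1))⁻¹ *
                (U (0, q.1.2))⁻¹)).trace.re) ≤ t} ≤
          K * MeasureTheory.Measure.pi (fun _ : Edge 4 1 => haarProbability G)
            {U : GaugeConfig 4 1 G | ∑ q : {q : Fin 4 × Fin 4 // q.1 < q.2},
              ((r.N : ℝ) - (r.ρ (U (0, q.1.1) * U (0, q.1.2) * (U (0, q.1.1))⁻¹ *
                (U (0, q.1.2))⁻¹)).trace.re) ≤ t / 4} := by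
  intro G _ _ _ _ _ _ r
  obtain ⟨K, t₀, ht₀, h⟩ :=
    stub_sublevelDoubling stub_expCommutatorBracket stub_koszulH1 stub_haarCoLipschitz G r 1
  refine ⟨K, t₀, ht₀, fun t ht htt => ?_⟩
  have hset : ∀ s : ℝ, {U : GaugeConfig 4 1 G | ∑ q : {q : Fin 4 × Fin 4 // q.1 < q.2},
      ((r.N : ℝ) - (r.ρ (U (0, q.1.1) * U (0, q.1.2) * (U (0, q.1.1))⁻¹ *
        (U (0, q.1.2))⁻¹)).trace.re) ≤ s} = {U : GaugeConfig 4 1 G | wilsonAction r.ρ U ≤ s} := by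
    intro s
    ext U
    simp only [Set.mem_setOf_eq, OneSite.wilsonAction_eq_commutatorCost]
  rw [hset t, hset (t / 4)]
  exact h t ht htt

end Summit.QuantumFields.YangMills.Theorems.FemtoCurvatureTwoPointC

end
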